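import Summits.ResolutionOfSingularities.ResolutionOfSingularities.Theorems.EquisingularLiftEquisingularLiftNatNDRoundModelSplit
import Summits.ResolutionOfSingularities.ResolutionOfSingularities.Theorems.EquisingularLiftEquisingularLiftNatNDFrameChartFlat
import Literature.AlgebraicGeometry.Resolution.BlowupsFlatBaseChange
import Literature.AlgebraicGeometry.Resolution.AlterationsNormalFormBlowupFormal
import Literature.AlgebraicGeometry.Resolution.PermissibleCentres
import Literature.AlgebraicGeometry.Resolution.MarkedIdealsEtale
import Literature.AlgebraicGeometry.Resolution.StrictTransformSupport
import Literature.AlgebraicGeometry.Resolution.StrictTransformDistinct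
import Literature.AlgebraicGeometry.Resolution.IdealSheafLemmas
import Literature.AlgebraicGeometry.Resolution.BlowupsProperProofs
import HarnessLib

/-!
# (B4β0) `transportInit : ND.TransportInit n k` — the point blow-up of `x` and any blow-up of the origin of `𝔸ⁿ_k` give the first F-stage and the
# first LINK over `Spec 𝒪_{F₁,x}`

[OURS · L1 W4.5b · EL♮(3) stmt-ResolutionOfSingularities-20148 · desk R31 (β) «ND-K5», (B4β) sub-split §13.15 of idea-1's SPEC v11, brick (B4β0) ·
res-L1-w45b-stub-2 g14 (the WIDTH TABLE D1′ (B4β) assembler)] — NOT a statement of the manuscript [Hironaka2017]; counted 0; AI kernel work weaker than expert review.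
Closes BY NAME the (B4β0) clause `ND.TransportInit` of `…NatNDRoundModelSplit` (idea-1's port draft v4, ported by lead-2): together with (B4β1) `transportStep`
(nose-w2) and (B4β2) `transportEnd` (iso-w2) it yields (B4β) `transportRound` through the PROVED composition `ND.transportRound_of_toricStage` (and, with the
model bricks (B4α·), `RoundAtNDFrame` / `hres_toricRounds` of the ND rung).

* `FStage` of the point blow-up `υ : F₂ → F₁` of the closed point `x` (with `F₁` locally Noetherian — the LN clause sustained by the desk 2026-08-28T14:52Z):
  `F₂` locally Noetherian (`IsBlowup.isProper`, `LocallyOfFiniteType.isLocallyNoetherian`), `υ` an iso off `x` (`IsBlowup.isIso_morphismRestrict`),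
  `closure υ⁻¹(T₁∖{x}) ∩ υ⁻¹{x}ᶜ = υ⁻¹(T₁∖{x})`, and the non-frame members of the stepped frame boundary lie over `x` (the ray `𝟙` carries `𝓘{x}·𝒪_{F₂}`, the
  others `⊤`).
* `Linked` (`exists_linked_init`): `L := F₂ ×_{F₁} Spec 𝒪_{F₁,x}` is a blow-up of `Spec 𝒪_x` along `𝓘{x}·𝒪 = 𝔪_x` (`flat_fromSpecStalk`,
  `IsBlowup.pullback_snd_of_flat`, `comap_fromSpecStalk_eq_ofIdealTop`, `stalkIdeal_vanishingIdeal_singleton`); so is `A₂ ×_{𝔸ⁿ} Spec 𝒪_x` along the FLAT frame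
  base map `t ↦ w` (iso-w2's `ND.flat_frameChart`; `𝓘{0}·𝒪_x = 𝔪_x` by `ND.map_originIdeal_frameChart` and the affine dictionary
  `vanishingIdeal_zeroLocus_eq_ofIdealTop` — on `Spec A` the vanishing ideal sheaf of `V(I)` is the sheaf of `√I` — with `comap_ofIdealTop_SpecMap`); uniqueness of
  blow-ups (`IsBlowup.unique`) gives `b : L → A₂` and the second cartesian square (`IsPullback.of_iso_pullback`). The stepped boundaries agree on `L`: the ray `𝟙` by
  functoriality, the frame rays by `comap_strictTransformIdeal_of_flat` on both squares and `(W_j)·𝒪_x = (w_j) = (X_j)·𝒪_x` (`X_j` prime ⇒ radical), the other rays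
  `⊤`. The closed sets agree: both preimages are supports of strict transforms (`support_strictTransformIdeal_eq_closure` on `F₂`, `A₂` and twice on `L`), pulled back
  by `comap_strictTransformIdeal_of_flat`, of divisors with the same trace on `Spec 𝒪_x` (`𝓘(T₁)_x = (g(w))` and `h⁻¹V(g) = V(g(w))`, `fromSpecStalk_mem_support_iff`).
Unused hypotheses of the Prop (honest): `Scheme.IsRegular F₁`, `LocalNDWon g`, `IsAlgClosed k`.

[cite: GortzWedhorn2020, Prop. 13.91 (2)(3) and (13.19) p. 414] [cite: StacksProject, Tag 0804] [cite: Matsumura1987, Thm. 7.4]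
-/

set_option linter.dupNamespace false -- mandated namespace `Summit.<Summit>.<Problem>` of this single-conjunct summit

noncomputable section

open CategoryTheory CategoryTheory.Limits AlgebraicGeometry TopologicalSpace Topology IsLocalRing
open Literature.AlgebraicGeometry.Resolution
open AlgebraicGeometry.Scheme.IdealSheafData

namespace Summit.ResolutionOfSingularities.ResolutionOfSingularities.Cruxes.EquisingularLiftNat.Sections.ND

open Summit.ResolutionOfSingularities.ResolutionOfSingularities.Cruxes.EquisingularLiftNat.Sections

universe u

/-! ## Topology of the point step -/

section PointStep

variable {n : ℕ} {F₁ F₂ : Scheme.{0}} {x : F₁} (hx : IsClosed ({x} : Set F₁)) (T₁ : Set F₁) (W : Fin n → F₁.IdealSheafData)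
  {υ : F₂ ⟶ F₁} (hυ : IsBlowup υ (vanishingIdeal (⟨{x}, hx⟩ : Closeds F₁)))

include hυ in
/-- The point blow-up is an isomorphism off the point. [cite: GortzWedhorn2020, Prop. 13.91 (3)] -/
theorem isIso_morphismRestrict_pointStep : IsIso (υ ∣_ (⟨{x}ᶜ, hx.isOpen_compl⟩ : F₁.Opens)) := by
  refine hυ.isIso_morphismRestrict ?_
  rw [Scheme.IdealSheafData.coe_support_vanishingIdeal]
  exact disjoint_compl_left

omit hx in
/-- Exact bookkeeping off the point: `closure υ⁻¹(T₁ ∖ {x}) ∩ υ⁻¹{x}ᶜ = υ⁻¹(T₁ ∖ {x})` for `T₁` closed. [folklore] -/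
theorem closure_preimage_diff_inter (hT₁ : IsClosed T₁) (υ : F₂ ⟶ F₁) :
    closure (υ ⁻¹' (T₁ \ {x})) ∩ υ ⁻¹' {x}ᶜ = υ ⁻¹' (T₁ \ {x}) := by
  apply Set.Subset.antisymm
  · rintro y ⟨hy, hyx⟩
    have h1 : y ∈ υ ⁻¹' T₁ := (hT₁.preimage υ.continuous).closure_subset_iff.mpr
      (Set.preimage_mono Set.sdiff_subset) hy
    exact ⟨h1, hyx⟩
  · intro y hy
    exact ⟨subset_closure hy, hy.2⟩

/-- The non-frame members of the stepped frame boundary lie over the point. [OURS] -/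
theorem support_stepAlong_frameBoundary_subset {ρ : Ray n} (hρ : ρ ∉ Set.range (e n)) :
    (((frameBoundary W).stepAlong (vanishingIdeal (⟨{x}, hx⟩ : Closeds F₁)) 1 υ ρ).support : Set F₂) ⊆ υ ⁻¹' {x} := by
  by_cases hρ1 : ρ = 1
  · subst hρ1
    rw [stepAlong_self, Scheme.IdealSheafData.support_comap]
    intro y hy
    have : υ y ∈ ((vanishingIdeal (⟨{x}, hx⟩ : Closeds F₁)).support : Set F₁) := hy
    rwa [Scheme.IdealSheafData.coe_support_vanishingIdeal] at this
  · rw [stepAlong_eq_top _ _ hρ1 υ (frameBoundary_of_not_mem_range W hρ), Scheme.IdealSheafData.support_top]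
    intro y hy
    exact absurd hy id

end PointStep

/-! ## The affine dictionary on `Spec A`: vanishing ideal sheaves of zero loci -/

section SpecDictionary

/-- **On `Spec A`, the vanishing ideal sheaf of `V(I)` is the ideal sheaf of `√I`** (through `A ≅ Γ(Spec A, ⊤)`). [folklore] -/
theorem vanishingIdeal_zeroLocus_eq_ofIdealTop {A : Type u} [CommRing A] (I : Ideal A) :
    vanishingIdeal (⟨PrimeSpectrum.zeroLocus (I : Set A), PrimeSpectrum.isClosed_zeroLocus _⟩ : Closeds (Spec (.of A))) =
      ofIdealTop (I.radical.map (Scheme.ΓSpecIso (.of A)).inv.hom) := by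
  refine Scheme.IdealSheafData.ext_of_isAffine ?_
  have hsurj : Function.Surjective (Scheme.ΓSpecIso (.of A)).inv.hom :=
    (ConcreteCategory.bijective_of_isIso (C := CommRingCat) (Scheme.ΓSpecIso (.of A)).inv).2
  have hinj : Function.Injective (Scheme.ΓSpecIso (.of A)).inv.hom :=
    (ConcreteCategory.bijective_of_isIso (C := CommRingCat) (Scheme.ΓSpecIso (.of A)).inv).1
  have hpre : ((isAffineOpen_top (Spec (CommRingCat.of A))).fromSpec : _ → Spec (CommRingCat.of A)) ⁻¹'
      PrimeSpectrum.zeroLocus (I : Set A) =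
      PrimeSpectrum.zeroLocus ((Scheme.ΓSpecIso (.of A)).inv.hom '' (I : Set A)) := by
    rw [IsAffineOpen.fromSpec_top, Scheme.isoSpec_Spec_inv]
    ext q
    rw [Set.mem_preimage, Spec.map_apply]
    exact Set.ext_iff.mp (PrimeSpectrum.preimage_comap_zeroLocus (Scheme.ΓSpecIso (.of A)).inv.hom (I : Set A)) q
  rw [ideal_ofIdealTop_top, Scheme.IdealSheafData.vanishingIdeal_ideal, Closeds.coe_mk]
  have hgoal : PrimeSpectrum.vanishingIdeal (PrimeSpectrum.zeroLocus ((Scheme.ΓSpecIso (.of A)).inv.hom '' (I : Set A))) =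
      I.radical.map (Scheme.ΓSpecIso (.of A)).inv.hom := by
    rw [← PrimeSpectrum.zeroLocus_span, PrimeSpectrum.vanishingIdeal_zeroLocus_eq_radical, ← Ideal.map_span, Ideal.span_eq,
      Ideal.map_radical_of_surjective hsurj ((RingHom.injective_iff_ker_eq_bot _).mp hinj ▸ bot_le)]
  exact (congrArg PrimeSpectrum.vanishingIdeal hpre).trans hgoal

/-- The vanishing ideal sheaf of a zero locus does not change when the ideal is replaced by one with the same radical; radical ideals need
no radical. [folklore] -/
theorem vanishingIdeal_zeroLocus_eq_ofIdealTop_of_isRadical {A : Type u} [CommRing A] (I : Ideal A) (hI : I.IsRadical) :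
    vanishingIdeal (⟨PrimeSpectrum.zeroLocus (I : Set A), PrimeSpectrum.isClosed_zeroLocus _⟩ : Closeds (Spec (.of A))) =
      ofIdealTop (I.map (Scheme.ΓSpecIso (.of A)).inv.hom) := by
  rw [vanishingIdeal_zeroLocus_eq_ofIdealTop, hI.radical]

/-- The closed point of a maximal ideal is the zero locus of that ideal. [folklore] -/
theorem singleton_eq_zeroLocus_of_isMaximal {A : Type u} [CommRing A] (p : PrimeSpectrum A) (hp : p.asIdeal.IsMaximal) :
    ({p} : Set (PrimeSpectrum A)) = PrimeSpectrum.zeroLocus (p.asIdeal : Set A) := by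
  rw [← PrimeSpectrum.vanishingIdeal_singleton, PrimeSpectrum.zeroLocus_vanishingIdeal_eq_closure,
    ((PrimeSpectrum.isClosed_singleton_iff_isMaximal p).mpr hp).closure_eq]

end SpecDictionary

/-! ## The local base `Spec 𝒪_{F₁,x}`: the point's ideal, the frame members and the old strict transform's trace, pulled back along
`fromSpecStalk` and along the frame base map -/

section LocalBase

variable (n : ℕ) (k : Type) [Field k] {F₁ : Scheme.{0}}
  (ρ : F₁ ⟶ (Literature.AlgebraicGeometry.Motives.projectiveSpace n k).left) {x : F₁} (hx : IsClosed ({x} : Set F₁))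
  (W : Fin n → F₁.IdealSheafData) (w : Fin n → F₁.presheaf.stalk x) (g : MvPolynomial (Fin n) k)
  (h1 : ∀ j, stalkIdeal (W j) x = Ideal.span {w j})
  (h2 : Ideal.span (Set.range w) = IsLocalRing.maximalIdeal (F₁.presheaf.stalk x))

/-- `𝓘{x}·𝒪_{Spec 𝒪_x}` is the ideal sheaf of `𝔪_x`. [folklore] -/
theorem comap_fromSpecStalk_vanishingIdeal_singleton :
    (vanishingIdeal (⟨{x}, hx⟩ : Closeds F₁)).comap (F₁.fromSpecStalk x) =
      ofIdealTop ((IsLocalRing.maximalIdeal (F₁.presheaf.stalk x)).map (Scheme.ΓSpecIso (F₁.presheaf.stalk x)).inv.hom) := by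
  rw [comap_fromSpecStalk_eq_ofIdealTop, stalkIdeal_vanishingIdeal_singleton]

include h1 in
/-- A frame member pulls back to the ideal sheaf of its stalk generator. [folklore] -/
theorem comap_fromSpecStalk_frame (j : Fin n) :
    (W j).comap (F₁.fromSpecStalk x) = ofIdealTop ((Ideal.span {w j}).map (Scheme.ΓSpecIso (F₁.presheaf.stalk x)).inv.hom) := by
  rw [comap_fromSpecStalk_eq_ofIdealTop, h1 j]

include h2 in
/-- `𝓘{origin}·𝒪_{Spec 𝒪_x} = 𝔪_x` along the frame base map `t ↦ w` (iso-w2's `map_originIdeal_frameChart`). [OURS] -/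
theorem comap_frameBaseMap_vanishingIdeal_origin :
    (vanishingIdeal (⟨{affOrigin n k}, isClosed_affOrigin n k⟩ : Closeds (Aff n k))).comap
        (Spec.map (CommRingCat.ofHom (MvPolynomial.eval₂Hom (baseToStalk n k ρ x) w))) =
      ofIdealTop ((IsLocalRing.maximalIdeal (F₁.presheaf.stalk x)).map (Scheme.ΓSpecIso (F₁.presheaf.stalk x)).inv.hom) := by
  have hZ : (⟨{affOrigin n k}, isClosed_affOrigin n k⟩ : Closeds (Aff n k)) =
      ⟨PrimeSpectrum.zeroLocus ((originIdeal k n : Ideal (MvPolynomial (Fin n) k)) : Set (MvPolynomial (Fin n) k)),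
        PrimeSpectrum.isClosed_zeroLocus _⟩ :=
    Closeds.ext (singleton_eq_zeroLocus_of_isMaximal (affOrigin n k) (originIdeal.isMaximal k n))
  rw [hZ, vanishingIdeal_zeroLocus_eq_ofIdealTop_of_isRadical _ (originIdeal.isMaximal k n).isPrime.isRadical]
  erw [comap_ofIdealTop_SpecMap]
  rw [(map_originIdeal_frameChart n k F₁ ρ x w h2).1]
  rfl

/-- A coordinate hyperplane pulls back, along the frame base map, to the ideal sheaf of the corresponding frame parameter. [OURS] -/
theorem comap_frameBaseMap_coordHyperplane (j : Fin n) :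
    (coordHyperplane n k j).comap (Spec.map (CommRingCat.ofHom (MvPolynomial.eval₂Hom (baseToStalk n k ρ x) w))) =
      ofIdealTop ((Ideal.span {w j}).map (Scheme.ΓSpecIso (F₁.presheaf.stalk x)).inv.hom) := by
  have hZ : (⟨PrimeSpectrum.zeroLocus {(MvPolynomial.X j : MvPolynomial (Fin n) k)}, PrimeSpectrum.isClosed_zeroLocus _⟩ : Closeds (Aff n k)) =
      ⟨PrimeSpectrum.zeroLocus ((Ideal.span {(MvPolynomial.X j : MvPolynomial (Fin n) k)} : Ideal _) : Set (MvPolynomial (Fin n) k)),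
        PrimeSpectrum.isClosed_zeroLocus _⟩ :=
    Closeds.ext (PrimeSpectrum.zeroLocus_span _).symm
  have hrad : (Ideal.span {(MvPolynomial.X j : MvPolynomial (Fin n) k)}).IsRadical :=
    ((Ideal.span_singleton_prime (MvPolynomial.X_ne_zero j)).mpr (MvPolynomial.X_prime (i := j))).isRadical
  unfold coordHyperplane
  rw [hZ, vanishingIdeal_zeroLocus_eq_ofIdealTop_of_isRadical _ hrad]
  erw [comap_ofIdealTop_SpecMap]
  rw [Ideal.map_span, Set.image_singleton, MvPolynomial.coe_eval₂Hom, MvPolynomial.eval₂_X]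
  rfl

/-- Points of `Spec 𝒪_x` over the trace of the closed set `T₁` are the points over `V(g)` under the frame base map, when `𝓘(T₁)_x = (g(w))`. [OURS] -/
theorem mem_support_comap_fromSpecStalk_iff (T₁ : Set F₁) (hT₁ : IsClosed T₁)
    (h5 : stalkIdeal (vanishingIdeal (⟨closure T₁, isClosed_closure⟩ : Closeds F₁)) x =
      Ideal.span {MvPolynomial.eval₂ (baseToStalk n k ρ x) w g})
    (q : Spec (F₁.presheaf.stalk x)) :
    q ∈ (((vanishingIdeal (⟨T₁, hT₁⟩ : Closeds F₁)).comap (F₁.fromSpecStalk x)).support : Set (Spec (F₁.presheaf.stalk x))) ↔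
      q ∈ (((vanishingIdeal (⟨PrimeSpectrum.zeroLocus {g}, PrimeSpectrum.isClosed_zeroLocus _⟩ : Closeds (Aff n k))).comap
        (Spec.map (CommRingCat.ofHom (MvPolynomial.eval₂Hom (baseToStalk n k ρ x) w)))).support : Set (Spec (F₁.presheaf.stalk x))) := by
  have hT : (⟨closure T₁, isClosed_closure⟩ : Closeds F₁) = ⟨T₁, hT₁⟩ := Closeds.ext hT₁.closure_eq
  rw [hT] at h5
  rw [Scheme.IdealSheafData.support_comap, Scheme.IdealSheafData.support_comap, Closeds.coe_preimage, Closeds.coe_preimage,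
    Set.mem_preimage, Set.mem_preimage, fromSpecStalk_mem_support_iff, h5, Scheme.IdealSheafData.coe_support_vanishingIdeal,
    Closeds.coe_mk, Ideal.span_singleton_le_iff_mem]
  constructor
  · intro h a ha
    rw [Set.mem_singleton_iff.mp ha]
    exact h
  · intro h
    exact h (Set.mem_singleton g)

include h2 in
/-- Points of `Spec 𝒪_x` over `x` are the points over the origin under the frame base map. [OURS] -/
theorem mem_support_comap_fromSpecStalk_singleton_iff (q : Spec (F₁.presheaf.stalk x)) :
    q ∈ (((vanishingIdeal (⟨{x}, hx⟩ : Closeds F₁)).comap (F₁.fromSpecStalk x)).support : Set (Spec (F₁.presheaf.stalk x))) ↔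
      q ∈ (((vanishingIdeal (⟨{affOrigin n k}, isClosed_affOrigin n k⟩ : Closeds (Aff n k))).comap
        (Spec.map (CommRingCat.ofHom (MvPolynomial.eval₂Hom (baseToStalk n k ρ x) w)))).support : Set (Spec (F₁.presheaf.stalk x))) := by
  rw [comap_fromSpecStalk_vanishingIdeal_singleton, comap_frameBaseMap_vanishingIdeal_origin n k ρ w h2]

end LocalBase

/-! ## The first LINK: `Bl_x F₁ ×_{F₁} Spec 𝒪_x ≅ Bl_𝔪 Spec 𝒪_x ≅ Bl_0 𝔸ⁿ ×_{𝔸ⁿ} Spec 𝒪_x` -/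

section LinkInit

variable (n : ℕ) (k : Type) [Field k] {F₁ F₂ A₂ : Scheme.{0}} [IsLocallyNoetherian F₁]
  (ρ : F₁ ⟶ (Literature.AlgebraicGeometry.Motives.projectiveSpace n k).left) {x : F₁} (hx : IsClosed ({x} : Set F₁))
  (T₁ : Set F₁) (hT₁ : IsClosed T₁) (W : Fin n → F₁.IdealSheafData) (w : Fin n → F₁.presheaf.stalk x) (g : MvPolynomial (Fin n) k)
  (h1 : ∀ j, stalkIdeal (W j) x = Ideal.span {w j})
  (h2 : Ideal.span (Set.range w) = IsLocalRing.maximalIdeal (F₁.presheaf.stalk x))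
  (h3 : ringKrullDim (F₁.presheaf.stalk x) = (n : WithBot ℕ∞))
  (h5 : stalkIdeal (vanishingIdeal (⟨closure T₁, isClosed_closure⟩ : Closeds F₁)) x =
    Ideal.span {MvPolynomial.eval₂ (baseToStalk n k ρ x) w g})
  {υ : F₂ ⟶ F₁} (hυ : IsBlowup υ (vanishingIdeal (⟨{x}, hx⟩ : Closeds F₁)))
  {π₀ : A₂ ⟶ Aff n k} (hπ₀ : IsBlowup π₀ (vanishingIdeal (⟨{affOrigin n k}, isClosed_affOrigin n k⟩ : Closeds (Aff n k))))

include h1 h2 h3 h5 hυ hπ₀ hT₁ in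
/-- **The first link.** After the point blow-up `υ` of `x` and ANY blow-up `π₀` of the origin of `𝔸ⁿ_k`, the fibre product
`L := F₂ ×_{F₁} Spec 𝒪_{F₁,x}` is also the fibre product `A₂ ×_{𝔸ⁿ_k} Spec 𝒪_{F₁,x}` along the frame base map `t ↦ w` (both are blow-ups of
`Spec 𝒪_x` along `𝔪_x`: `IsBlowup.pullback_snd_of_flat` with `flat_fromSpecStalk` / `flat_frameChart`, `𝓘{origin}·𝒪_x = 𝔪_x`, uniqueness of
blow-ups), the stepped frame boundaries pull back to the same boundary on `L` (`comap_strictTransformIdeal_of_flat`; `(W j)·𝒪_x = (w_j) = (X_j)·𝒪_x`),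
and so do the strict transforms of `T₁` and of `V(g)` (`support_strictTransformIdeal_eq_closure`; `𝓘(T₁)_x = (g(w))`).
[cite: GortzWedhorn2020, Prop. 13.91 (2) and (13.19)] [OURS · L1 W4.5b · (B4β0)] -/
theorem exists_linked_init :
    ∃ (L : Scheme.{0}) (a : L ⟶ F₂) (b : L ⟶ A₂) (c : L ⟶ Spec (F₁.presheaf.stalk x)),
      IsPullback a c υ (F₁.fromSpecStalk x) ∧
      IsPullback b c π₀ (Spec.map (CommRingCat.ofHom (MvPolynomial.eval₂Hom (baseToStalk n k ρ x) w))) ∧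
      (∀ ρ', ((frameBoundary W).stepAlong (vanishingIdeal (⟨{x}, hx⟩ : Closeds F₁)) 1 υ ρ').comap a =
        ((frameBoundary (coordHyperplane n k)).stepAlong
          (vanishingIdeal (⟨{affOrigin n k}, isClosed_affOrigin n k⟩ : Closeds (Aff n k))) 1 π₀ ρ').comap b) ∧
      a ⁻¹' closure (υ ⁻¹' (T₁ \ {x})) = b ⁻¹' closure (π₀ ⁻¹' (PrimeSpectrum.zeroLocus {g} \ {affOrigin n k})) := by
  -- flatness of the two base maps
  haveI hflatF : Flat (F₁.fromSpecStalk x) := flat_fromSpecStalk F₁ x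
  have hφ : (MvPolynomial.eval₂Hom (baseToStalk n k ρ x) w).Flat := flat_frameChart n k F₁ ρ x w h2 h3
  haveI hflatA : Flat (Spec.map (CommRingCat.ofHom (MvPolynomial.eval₂Hom (baseToStalk n k ρ x) w))) :=
    (HasRingHomProperty.Spec_iff (P := @Flat)).mpr hφ
  -- Noetherian bookkeeping
  haveI : IsProper υ := hυ.isProper
  haveI : IsLocallyNoetherian F₂ := LocallyOfFiniteType.isLocallyNoetherian υ
  haveI : IsProper π₀ := hπ₀.isProper
  haveI : IsLocallyNoetherian A₂ := LocallyOfFiniteType.isLocallyNoetherian π₀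
  -- the F-side fibre product, a blow-up of `Spec 𝒪_x` along `𝔪_x`
  have hsqF : IsPullback (pullback.fst υ (F₁.fromSpecStalk x)) (pullback.snd υ (F₁.fromSpecStalk x)) υ (F₁.fromSpecStalk x) :=
    IsPullback.of_hasPullback _ _
  have hc : IsBlowup (pullback.snd υ (F₁.fromSpecStalk x)) ((vanishingIdeal (⟨{x}, hx⟩ : Closeds F₁)).comap (F₁.fromSpecStalk x)) :=
    hυ.pullback_snd_of_flat _
  haveI : IsProper (pullback.snd υ (F₁.fromSpecStalk x)) := hc.isProper
  haveI : IsLocallyNoetherian (pullback υ (F₁.fromSpecStalk x)) :=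
    LocallyOfFiniteType.isLocallyNoetherian (pullback.snd υ (F₁.fromSpecStalk x))
  haveI : Flat (pullback.fst υ (F₁.fromSpecStalk x)) := MorphismProperty.of_isPullback hsqF.flip hflatF
  -- the model-side fibre product, a blow-up of `Spec 𝒪_x` along the same ideal
  have hJ : (vanishingIdeal (⟨{x}, hx⟩ : Closeds F₁)).comap (F₁.fromSpecStalk x) =
      (vanishingIdeal (⟨{affOrigin n k}, isClosed_affOrigin n k⟩ : Closeds (Aff n k))).comap
        (Spec.map (CommRingCat.ofHom (MvPolynomial.eval₂Hom (baseToStalk n k ρ x) w))) := by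
    rw [comap_fromSpecStalk_vanishingIdeal_singleton, comap_frameBaseMap_vanishingIdeal_origin n k ρ w h2]
  have hc' : IsBlowup (pullback.snd π₀ (Spec.map (CommRingCat.ofHom (MvPolynomial.eval₂Hom (baseToStalk n k ρ x) w))))
      ((vanishingIdeal (⟨{x}, hx⟩ : Closeds F₁)).comap (F₁.fromSpecStalk x)) := by
    rw [hJ]; exact hπ₀.pullback_snd_of_flat _
  obtain ⟨eL, he1, -⟩ := hc.unique hc'
  have hsqA : IsPullback (eL.hom ≫ pullback.fst π₀ _) (pullback.snd υ (F₁.fromSpecStalk x)) π₀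
      (Spec.map (CommRingCat.ofHom (MvPolynomial.eval₂Hom (baseToStalk n k ρ x) w))) := by
    refine IsPullback.of_iso_pullback ⟨?_⟩ eL rfl he1
    rw [Category.assoc, pullback.condition, ← Category.assoc, he1]
    rfl
  haveI : Flat (pullback.fst π₀ (Spec.map (CommRingCat.ofHom (MvPolynomial.eval₂Hom (baseToStalk n k ρ x) w)))) :=
    MorphismProperty.of_isPullback (IsPullback.of_hasPullback _ _).flip hflatA
  haveI : Flat (eL.hom ≫ pullback.fst π₀ (Spec.map (CommRingCat.ofHom (MvPolynomial.eval₂Hom (baseToStalk n k ρ x) w)))) :=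
    inferInstance
  refine ⟨_, pullback.fst υ (F₁.fromSpecStalk x), eL.hom ≫ pullback.fst π₀ _, pullback.snd υ (F₁.fromSpecStalk x), hsqF, hsqA, ?_, ?_⟩
  · -- the boundaries
    intro ρ'
    by_cases hρ1 : ρ' = 1
    · subst hρ1
      rw [stepAlong_self, stepAlong_self, ← Scheme.IdealSheafData.comap_comp, ← Scheme.IdealSheafData.comap_comp, hsqF.w, hsqA.w,
        Scheme.IdealSheafData.comap_comp, Scheme.IdealSheafData.comap_comp, hJ]
      rfl
    · rw [stepAlong_of_ne _ _ hρ1, stepAlong_of_ne _ _ hρ1, comap_strictTransformIdeal_of_flat (F₁.fromSpecStalk x) hsqF.w,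
        comap_strictTransformIdeal_of_flat _ hsqA.w, hJ]
      by_cases hρe : ρ' ∈ Set.range (e n)
      · obtain ⟨j, rfl⟩ := hρe
        rw [frameBoundary_e, frameBoundary_e, comap_fromSpecStalk_frame n W w h1]
        exact congrArg _ (comap_frameBaseMap_coordHyperplane n k ρ w j).symm
      · rw [frameBoundary_of_not_mem_range _ hρe, frameBoundary_of_not_mem_range _ hρe, Scheme.IdealSheafData.comap_top,
          Scheme.IdealSheafData.comap_top]
        rfl
  · -- the closed sets `T`
    have hTF : closure (υ ⁻¹' (T₁ \ {x})) =
        ((strictTransformIdeal υ (vanishingIdeal (⟨{x}, hx⟩ : Closeds F₁)) (vanishingIdeal (⟨T₁, hT₁⟩ : Closeds F₁))).support : Set F₂) := by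
      rw [support_strictTransformIdeal_eq_closure, Scheme.IdealSheafData.coe_support_vanishingIdeal,
        Scheme.IdealSheafData.coe_support_vanishingIdeal]
      rfl
    have hTA : closure (π₀ ⁻¹' (PrimeSpectrum.zeroLocus {g} \ {affOrigin n k})) =
        ((strictTransformIdeal π₀ (vanishingIdeal (⟨{affOrigin n k}, isClosed_affOrigin n k⟩ : Closeds (Aff n k)))
          (vanishingIdeal (⟨PrimeSpectrum.zeroLocus {g}, PrimeSpectrum.isClosed_zeroLocus _⟩ : Closeds (Aff n k)))).support : Set A₂) := by
      rw [support_strictTransformIdeal_eq_closure, Scheme.IdealSheafData.coe_support_vanishingIdeal,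
        Scheme.IdealSheafData.coe_support_vanishingIdeal]
      rfl
    have hpre : ∀ {Y Z : Scheme.{0}} (f : Y ⟶ Z) (I : Z.IdealSheafData), f ⁻¹' (I.support : Set Z) = ((I.comap f).support : Set Y) := by
      intro Y Z f I
      rw [Scheme.IdealSheafData.support_comap]; rfl
    rw [hTF, hTA, hpre, hpre, comap_strictTransformIdeal_of_flat (F₁.fromSpecStalk x) hsqF.w, comap_strictTransformIdeal_of_flat _ hsqA.w, hJ,
      support_strictTransformIdeal_eq_closure, support_strictTransformIdeal_eq_closure]
    have hS : (((vanishingIdeal (⟨T₁, hT₁⟩ : Closeds F₁)).comap (F₁.fromSpecStalk x)).support : Set (Spec (F₁.presheaf.stalk x))) =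
        (((vanishingIdeal (⟨PrimeSpectrum.zeroLocus {g}, PrimeSpectrum.isClosed_zeroLocus _⟩ : Closeds (Aff n k))).comap
          (Spec.map (CommRingCat.ofHom (MvPolynomial.eval₂Hom (baseToStalk n k ρ x) w)))).support : Set (Spec (F₁.presheaf.stalk x))) :=
      Set.ext fun q => mem_support_comap_fromSpecStalk_iff n k ρ w g T₁ hT₁ h5 q
    rw [hS]
    rfl

end LinkInit

/-! ## (B4β0) `transportInit` -/

section Brick

/-- **(B4β0) `transportInit`** — the point blow-up of `x` and any blow-up of the origin give the first F-stage and the first link. [OURS · L1 W4.5b · (B4β0)] -/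
theorem transportInit (n : ℕ) (k : Type) [Field k] [IsAlgClosed k] : TransportInit n k := by
  intro F₁ ρ T₁ _hreg hLN hT₁ x hx W w g h1 h2 h3 _h4 h5 F₂ υ hυ A₂ π₀ hπ₀
  haveI := hLN
  haveI : IsProper υ := hυ.isProper
  refine ⟨⟨LocallyOfFiniteType.isLocallyNoetherian υ, isIso_morphismRestrict_pointStep hx hυ, closure_preimage_diff_inter T₁ hT₁ υ,
    isClosed_closure, fun ρ' hρ' => support_stepAlong_frameBoundary_subset hx W hρ'⟩, ?_⟩
  exact exists_linked_init n k ρ hx T₁ hT₁ W w g h1 h2 h3 h5 hυ hπ₀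

end Brick

end Summit.ResolutionOfSingularities.ResolutionOfSingularities.Cruxes.EquisingularLiftNat.Sections.ND

end
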